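import Literature.AnabelianGeometry.AbsoluteAnabelian.ArchimedeanHolFieldFunctorGeometricGaloisDescent
import Literature.Topology.CoveringSpaces.CoveringTwistedNaturalFamily
import HarnessLib

/-!
# [AbsTopIII] Prop. 4.2 (i) at the geometric model: «`EA` objects mapping to `𝕏`» is id-rigid for a
# connected Riemann surface with centre-free `π̂₁`, modulo «`Aut(𝕏) → Out(π̂₁(𝕏^top))` injective»

S. Mochizuki, *Topics in Absolute Anabelian Geometry III*, proof of Prop. 4.2 (i), kurims p.106 l.11–19
(«… follows from the slimness … of Lemma 4.3»). [cite: MochizukiAbsTopIII2015, Proposition 4.2 (i) p.106]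

PROOF-ONLY file (abc-iut cell, seat abc-iut-w5-d144 gen 4, row «H1PRIME-HOLRS», junction (J) at the
model; campaign-L R1.2, GAP row G-L4t14-R1).  Sequel of `ArchimedeanHolFieldFunctorGeometricGaloisDescent`
(the slice route with the categorical residual (H1′) «`Over.map σ ≅ 𝟭 ⇒ σ = 1`») and of the topological
junction `Literature/Topology/CoveringSpaces/CoveringTwistedNaturalFamily` («natural lifts of `σ` to
the connected finite covers ⇒ `(σ_*)⁻¹ ∘ Ad(δ)` inner on `π̂₁`»):

* `HolRS.exists_eq_conj_of_overMap_iso` — for an automorphism `σ` of a connected Riemann surface `𝕏`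
  with `Over.map σ ≅ 𝟭_{Over 𝕏}`, every endomorphism `θ` of `π₁(𝕏^top, x₀)` with
  `σ_* (θ γ) = δ⁻¹·γ·δ` (for a path `δ : x₀ ⇝ σ x₀`) is INNER on `π̂₁(𝕏^top, x₀)` — the components of
  the natural isomorphism are holomorphic self-maps of the connected finite covers over `σ`, natural
  along all maps of covers (fullness of abc-iut-L4-t12's `overToCovFin`).
* `HolRS.isIdRigid_mapsTo_of_center_eq_bot_of_outer`, `HolRS.isIdRigid_mapsTo_of_isSlimGroup_of_outer`
  — **print's Prop. 4.2 (i) at the model**: for `𝕏` with centre-free (resp. slim) `π̂₁(𝕏^top, x₀)`,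
  «objects of `EA` mapping to `𝕏`» is id-rigid MODULO (OUT) «an automorphism of `𝕏` acting on
  `π̂₁(𝕏^top, x₀)` by an inner automorphism is trivial», i.e. «`Aut(𝕏) → Out(π̂₁(𝕏^top))` injective»,
  stated concretely with a path `δ` and the twist `θ` (no quotient `Out` is formed).

HONEST SCOPE: (OUT) is a hypothesis — it is print's appeal to Lemma 4.3 for the orbicurve `[𝕏/⟨σ⟩]`
(relative slimness), true for hyperbolic Riemann surfaces of finite type, false (with the conclusion)
at `ℂˣ` or an elliptic curve; it is not proved here for any `𝕏`.  Classical mathematics; no definition,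
no instance, no Prop-valued fact; nothing here bears on [IUTchIII] Cor. 3.12; model ≠ reconstruction.

## References

* S. Mochizuki, *Topics in Absolute Anabelian Geometry III*, kurims ms, §0 p.27, Prop 4.2 (i) /
  Lemma 4.3 p.106. [MochizukiAbsTopIII2015]
* A. Hatcher, *Algebraic Topology*, CUP 2002, §1.3 (covering spaces, lifting). [HatcherAT2002]
-/

noncomputable section

open CategoryTheory Topology
open Literature.Topology.CoveringSpaces
open Literature.AlgebraicGeometry.Frobenioids (IsSlimGroup)
open Literature.IUT.HodgeTheaters (profiniteCompletion toCompletion)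

namespace Literature.AnabelianGeometry.AbsoluteAnabelian

namespace HolRS

variable (X : HolRS)

/-- **The junction at a connected Riemann surface.**  If the pull-back along an automorphism `σ` of
`𝕏` is isomorphic to the identity functor of the slice `Over 𝕏` (`Over.map σ ≅ 𝟭`), then for every
path `δ` from `x₀` to `σ x₀` and every endomorphism `θ` of `π₁(𝕏^top, x₀)` with `σ_* (θ γ) = δ⁻¹·γ·δ`,
`θ` is inner on the profinite completion: `ι(θ γ) = n⁻¹ ι(γ) n`.  (The components of the natural
isomorphism are holomorphic self-maps of the connected finite covers lying over `σ`, natural along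
all maps of covers by fullness of `Over 𝕏 ⥤ Cov^fin(𝕏^top)`; apply
`CovFin.exists_eq_conj_of_twisted_cover_family_of_map`.)
[cite: MochizukiAbsTopIII2015, Proposition 4.2 (i) p.106] -/
theorem exists_eq_conj_of_overMap_iso (σ : X ≅ X) (β : Over.map σ.hom ≅ 𝟭 (Over X))
    (x₀ : X.carrier) (δ : Path x₀ (σ.hom.toFun x₀))
    (θ : FundamentalGroup X.carrier x₀ →* FundamentalGroup X.carrier x₀)
    (hθ : ∀ γ : FundamentalGroup X.carrier x₀,
      Path.Homotopic.Quotient.map (FundamentalGroup.toPath (θ γ))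
          ⟨σ.hom.toFun, σ.hom.mdifferentiable.continuous⟩ =
        (Path.Homotopic.Quotient.mk δ).symm.trans
          ((FundamentalGroup.toPath γ).trans (Path.Homotopic.Quotient.mk δ))) :
    ∃ n : profiniteCompletion (FundamentalGroup X.carrier x₀),
      ∀ γ : FundamentalGroup X.carrier x₀, toCompletion _ (θ γ) = n⁻¹ * toCompletion _ γ * n := by
  classical
  haveI := pathConnectedSpace_carrier X
  haveI := stronglyLocallyContractibleSpace_carrier X
  haveI := X.overToCovFin_full
  haveI := X.overToCovFin_faithful
  -- the family of self-maps of the connected finite covers over `σ` (junk `id` on disconnected ones)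
  let b : ∀ E : CovFin X.carrier, E.obj.left → E.obj.left := fun E =>
    if hE : ConnectedSpace E.obj.left then (β.hom.app (@overOfCovFin X E hE)).left.toFun else id
  have hbE : ∀ (E : CovFin X.carrier) (hE : ConnectedSpace E.obj.left),
      b E = (β.hom.app (@overOfCovFin X E hE)).left.toFun := fun E hE => dif_pos hE
  refine CovFin.exists_eq_conj_of_twisted_cover_family_of_map x₀
    ⟨σ.hom.toFun, σ.hom.mdifferentiable.continuous⟩ δ θ hθ b ?_ ?_ ?_
  · -- continuity
    intro E hE
    rw [hbE E hE]
    exact (β.hom.app _).left.mdifferentiable.continuous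
  · -- over `σ`
    intro E hE y
    rw [hbE E hE]
    have h := X.over_w_apply (β.hom.app (@overOfCovFin X E hE)) y
    -- `((Over.map σ.hom).obj B).hom = B.hom ≫ σ.hom`
    simpa using h
  · -- naturality along maps of covers between connected covers
    intro E E' hE hE' k y
    rw [hbE E hE, hbE E' hE']
    -- lift `k` to the slice through the identity isomorphisms `overToCovFinObjIso`
    let k' : X.overToCovFin.obj (@overOfCovFin X E hE) ⟶ X.overToCovFin.obj (@overOfCovFin X E' hE') :=
      (@overToCovFinObjIso X E hE).hom ≫ k ≫ (@overToCovFinObjIso X E' hE').inv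
    let kk : (@overOfCovFin X E hE) ⟶ (@overOfCovFin X E' hE') := X.overToCovFin.preimage k'
    have hkk : ∀ z, kk.left.toFun z = k.hom.left z := fun z => by
      have h1 : (X.overToCovFin.map kk).hom.left z = kk.left.toFun z := rfl
      rw [← h1, X.overToCovFin.map_preimage]
      rfl
    have hnat := β.hom.naturality kk
    have hnat' := congrArg (fun t => t.left.toFun y) hnat
    simp only [Functor.id_map, Over.comp_left, comp_toFun, Function.comp_apply,
      Over.map_map_left] at hnat'
    rw [hkk, hkk] at hnat'
    exact hnat'

/-- **[AbsTopIII] Prop. 4.2 (i) at the geometric model, modulo «`Aut(𝕏) → Out(π̂₁(𝕏^top))` is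
injective».**  Let `𝕏` be a connected Riemann surface whose profinite fundamental group `π̂₁(𝕏^top, x₀)`
is centre-free.  Suppose (OUT) that every automorphism `σ` of `𝕏` acting on `π̂₁(𝕏^top, x₀)` by an
INNER automorphism is trivial — precisely: for every path `δ : x₀ ⇝ σ x₀` and endomorphism `θ` of
`π₁(𝕏^top, x₀)` with `σ_* (θ γ) = δ⁻¹·γ·δ`, if `ι ∘ θ` is conjugate to `ι` inside `π̂₁` then `σ = 1`.
Then the full subcategory of `HolRS` of objects mapping to `𝕏` (print's «objects of `EA` that map to
`X`») is ID-RIGID.  (Slice route: (H2) from centre-freeness, abc-iut-L4-t12; (H1′) from (OUT) through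
the junction `exists_eq_conj_of_overMap_iso`.)  (OUT) is where print invokes Lemma 4.3 for the
orbicurve `[X/⟨σ⟩]`; it holds for hyperbolic Riemann surfaces of finite type and FAILS (with the
conclusion) at `ℂˣ` or an elliptic curve.
[cite: MochizukiAbsTopIII2015, Proposition 4.2 (i) p.106] -/
theorem isIdRigid_mapsTo_of_center_eq_bot_of_outer (x₀ : X.carrier)
    (hZ : Subgroup.center (profiniteCompletion (FundamentalGroup X.carrier x₀)) = ⊥)
    (hout : ∀ (σ : X ≅ X) (δ : Path x₀ (σ.hom.toFun x₀))
      (θ : FundamentalGroup X.carrier x₀ →* FundamentalGroup X.carrier x₀),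
      (∀ γ : FundamentalGroup X.carrier x₀,
        Path.Homotopic.Quotient.map (FundamentalGroup.toPath (θ γ))
            ⟨σ.hom.toFun, σ.hom.mdifferentiable.continuous⟩ =
          (Path.Homotopic.Quotient.mk δ).symm.trans
            ((FundamentalGroup.toPath γ).trans (Path.Homotopic.Quotient.mk δ))) →
      (∃ n : profiniteCompletion (FundamentalGroup X.carrier x₀),
        ∀ γ : FundamentalGroup X.carrier x₀, toCompletion _ (θ γ) = n⁻¹ * toCompletion _ γ * n) →
      σ.hom = 𝟙 X) :
    IsIdRigid (ObjectProperty.FullSubcategory fun Y : HolRS => Nonempty (Y ⟶ X)) := by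
  refine X.isIdRigid_mapsTo_of_twist_of_center_eq_bot x₀ hZ fun σ hβ => ?_
  obtain ⟨β⟩ := hβ
  haveI := pathConnectedSpace_carrier X
  let δ : Path x₀ (σ.hom.toFun x₀) := PathConnectedSpace.somePath x₀ _
  -- the homeomorphism underlying `σ` and the twist `θ_{σ,δ} = (σ_*)⁻¹ ∘ Ad(δ)`
  let σ' : X.carrier ≃ₜ X.carrier :=
    { toFun := σ.hom.toFun
      invFun := σ.inv.toFun
      left_inv := fun y => congrFun (congrArg Hom.toFun σ.hom_inv_id) y
      right_inv := fun y => congrFun (congrArg Hom.toFun σ.inv_hom_id) y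
      continuous_toFun := σ.hom.mdifferentiable.continuous
      continuous_invFun := σ.inv.mdifferentiable.continuous }
  let θ : FundamentalGroup X.carrier x₀ →* FundamentalGroup X.carrier x₀ :=
    ((FundamentalGroup.fundamentalGroupMulEquivOfPath δ).trans
      (σ'.fundamentalGroupMulEquiv rfl).symm).toMonoidHom
  have hθ : ∀ γ : FundamentalGroup X.carrier x₀,
      Path.Homotopic.Quotient.map (FundamentalGroup.toPath (θ γ))
          ⟨σ.hom.toFun, σ.hom.mdifferentiable.continuous⟩ =
        (Path.Homotopic.Quotient.mk δ).symm.trans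
          ((FundamentalGroup.toPath γ).trans (Path.Homotopic.Quotient.mk δ)) :=
    fun γ => CovFin.map_twist_eq x₀ σ' δ γ
  exact hout σ δ θ hθ (X.exists_eq_conj_of_overMap_iso σ β x₀ δ θ hθ)

/-- The same with the SLIMNESS of `π̂₁(𝕏^top, x₀)` (print's Lemma 4.3 input for `𝕏` itself) in place
of centre-freeness. [cite: MochizukiAbsTopIII2015, Lemma 4.3 p.106] -/
theorem isIdRigid_mapsTo_of_isSlimGroup_of_outer (x₀ : X.carrier)
    (h : IsSlimGroup (profiniteCompletion (FundamentalGroup X.carrier x₀)))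
    (hout : ∀ (σ : X ≅ X) (δ : Path x₀ (σ.hom.toFun x₀))
      (θ : FundamentalGroup X.carrier x₀ →* FundamentalGroup X.carrier x₀),
      (∀ γ : FundamentalGroup X.carrier x₀,
        Path.Homotopic.Quotient.map (FundamentalGroup.toPath (θ γ))
            ⟨σ.hom.toFun, σ.hom.mdifferentiable.continuous⟩ =
          (Path.Homotopic.Quotient.mk δ).symm.trans
            ((FundamentalGroup.toPath γ).trans (Path.Homotopic.Quotient.mk δ))) →
      (∃ n : profiniteCompletion (FundamentalGroup X.carrier x₀),
        ∀ γ : FundamentalGroup X.carrier x₀, toCompletion _ (θ γ) = n⁻¹ * toCompletion _ γ * n) →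
      σ.hom = 𝟙 X) :
    IsIdRigid (ObjectProperty.FullSubcategory fun Y : HolRS => Nonempty (Y ⟶ X)) := by
  refine X.isIdRigid_mapsTo_of_twist_of_isSlimGroup x₀ h fun σ hβ => ?_
  obtain ⟨β⟩ := hβ
  haveI := pathConnectedSpace_carrier X
  let δ : Path x₀ (σ.hom.toFun x₀) := PathConnectedSpace.somePath x₀ _
  let σ' : X.carrier ≃ₜ X.carrier :=
    { toFun := σ.hom.toFun
      invFun := σ.inv.toFun
      left_inv := fun y => congrFun (congrArg Hom.toFun σ.hom_inv_id) y
      right_inv := fun y => congrFun (congrArg Hom.toFun σ.inv_hom_id) y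
      continuous_toFun := σ.hom.mdifferentiable.continuous
      continuous_invFun := σ.inv.mdifferentiable.continuous }
  let θ : FundamentalGroup X.carrier x₀ →* FundamentalGroup X.carrier x₀ :=
    ((FundamentalGroup.fundamentalGroupMulEquivOfPath δ).trans
      (σ'.fundamentalGroupMulEquiv rfl).symm).toMonoidHom
  have hθ : ∀ γ : FundamentalGroup X.carrier x₀,
      Path.Homotopic.Quotient.map (FundamentalGroup.toPath (θ γ))
          ⟨σ.hom.toFun, σ.hom.mdifferentiable.continuous⟩ =
        (Path.Homotopic.Quotient.mk δ).symm.trans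
          ((FundamentalGroup.toPath γ).trans (Path.Homotopic.Quotient.mk δ)) :=
    fun γ => CovFin.map_twist_eq x₀ σ' δ γ
  exact hout σ δ θ hθ (X.exists_eq_conj_of_overMap_iso σ β x₀ δ θ hθ)

end HolRS

end Literature.AnabelianGeometry.AbsoluteAnabelian
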